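/-
Copyright (c) 2026. All rights reserved.
Released under Apache 2.0 license as described in the file LICENSE.
Authors: HodgeCM publication cell (pub-hodgecm), GR lane, seat GR-2 (`pub-hodgecm-own-hyp34`).
-/
import Literature.NumberTheory.Weil1964.ArchSplitPlaceLeviSection
import HarnessLib

/-!
# The split real quadratic algebra `ℝ × ℝ` in quadratic coordinates, and the metaplectic section of its unitary groups

Topic `NumberTheory/Weil1964`; namespace `Literature.NumberTheory.Weil1964`.  KERNEL ONLY: definitions with bodies and
theorems; no `def … : Prop` record, no `axiom`, no proof hole.

At a REAL place `v` of a number field `F` that SPLITS in the quadratic extension `E = F(δ)`, `δ² = d` (i.e.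
`σ_v(d) > 0`), `E ⊗_F F_v = E_w × E_{w'} = ℝ × ℝ` for the two real places `w, w' = w ∘ c` of `E` over `v`, the
conjugation `c ⊗ 1` is the SWAP of the two factors, `δ ⊗ 1 = (s, -s)` with `s = σ_w(δ)`, `s² = σ_v(d)`, and
`E ⊗ F_v = F_v·1 ⊕ F_v·δ` ([MoeglinVignerasWaldspurger1987, Chap. 1 I.17–I.19]; the case `E = F ⊕ F` of
[Kudla1994, §3]).  This file records that elementary structure as an instance of the tree's quadratic coordinates
(`IsQuadraticCoordinates`, `QuadraticRestrictionOfScalars`) with NO number field in sight — the carrier is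
literally `ℝ × ℝ` over `ℝ`:

* §1 `splitRealCoords s hs : (ℝ × ℝ) ≃+ (ℝ × ℝ)`, `(a, b) ↦ (a + b s, a - b s)`, and
  **`isQuadraticCoordinates_splitReal`**: `IsQuadraticCoordinates (RingHom.prod id id) (splitRealCoords s hs) (s, -s) (s * s)`;
  the swap `Prod.swap = RingEquiv.prodComm` fixes the diagonal and negates `(s, -s)` (`swap_diag`, `swap_delta`);
  `two_mul_mul_inv_two_mul : 2 * s * (2 * s)⁻¹ = 1`.
* §2 hence, by `ArchSplitPlaceLeviSection` (L2–L4 of the general-`E/F` programme): for every symmetric real `T` with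
  `IsUnit T.det` and `H = T ⊗ 1 ∈ Mₙ(ℝ × ℝ)`, the unitary group
  `U(swap, H) = {g ∈ GLₙ(ℝ × ℝ) | (swap g)ᵀ H g = H}` — the archimedean component at `v` of `U(V)(𝔸_F)` — admits a
  HOMOMORPHIC SECTION into Folland's metaplectic group `Mp^𝓢(ℝⁿ)` over its symplectic embedding `toSymplecticDot`
  (**`exists_archSection_splitReal`**), given explicitly by `archSplitSection` for any lift of `splitCayleyDot⁻¹`,
  with the operators `S_x ∘ (|det g₊|^{-1/2} f ∘ g₊⁻¹) ∘ S_x⁻¹`, `g₊ = g.map evalPlus` the `E_w`-component of `g`.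

This is the place type (ii) "real split" of the programme note `GENERAL-EF-PLAN.md` (a CM extension has none);
the dictionary with `UnitaryGroup.arch F E c N J` (the `w`-coordinate projection) is the business of the sequel.

## References
* [MoeglinVignerasWaldspurger1987] C. Mœglin, M.-F. Vignéras, J.-L. Waldspurger, LNM 1291 (1987), Chap. 1 I.17–I.19,
  Chap. 2 III.1.
* [Kudla1994] S. S. Kudla, Israel J. Math. 87 (1994), §3 (`E = F ⊕ F`).
* [Folland1989] G. B. Folland, *Harmonic Analysis in Phase Space* (1989), §4.2 (4.24).
-/

set_option autoImplicit false

noncomputable section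

open Matrix
open Literature.RepresentationTheory.HeisenbergGroup
open Literature.NumberTheory.Automorphic
open Literature.NumberTheory.Automorphic.UnitaryGroup
open Literature.Analysis.SegalBargmann

namespace Literature.NumberTheory.Weil1964

/-! ## §1 `ℝ × ℝ = ℝ·1 ⊕ ℝ·(s, -s)` -/

section SplitReal

variable (s : ℝ) (hs : s ≠ 0)

/-- the quadratic coordinates of the split algebra: `(a, b) ↦ a·1 + b·(s, -s) = (a + b s, a - b s)`, with inverse
`(u, w) ↦ ((u + w)/2, (u - w)/(2s))`. [cite: MoeglinVignerasWaldspurger1987, Chap. 1 I.17] -/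
def splitRealCoords : (ℝ × ℝ) ≃+ (ℝ × ℝ) where
  toFun p := (p.1 + p.2 * s, p.1 - p.2 * s)
  invFun q := ((q.1 + q.2) / 2, (q.1 - q.2) / (2 * s))
  left_inv p := by
    ext
    · show (p.1 + p.2 * s + (p.1 - p.2 * s)) / 2 = p.1
      ring
    · show (p.1 + p.2 * s - (p.1 - p.2 * s)) / (2 * s) = p.2
      field_simp
      ring
  right_inv q := by
    ext
    · show (q.1 + q.2) / 2 + (q.1 - q.2) / (2 * s) * s = q.1
      field_simp
      ring
    · show (q.1 + q.2) / 2 - (q.1 - q.2) / (2 * s) * s = q.2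
      field_simp
      ring
  map_add' p q := by
    ext
    · show (p.1 + q.1) + (p.2 + q.2) * s = (p.1 + p.2 * s) + (q.1 + q.2 * s)
      ring
    · show (p.1 + q.1) - (p.2 + q.2) * s = (p.1 - p.2 * s) + (q.1 - q.2 * s)
      ring

/-- formula. [cite: MoeglinVignerasWaldspurger1987, Chap. 1 I.17] -/
@[simp] theorem splitRealCoords_apply (p : ℝ × ℝ) : splitRealCoords s hs p = (p.1 + p.2 * s, p.1 - p.2 * s) := rfl

/-- **`ℝ × ℝ` is a quadratic `ℝ`-algebra in the coordinates `1 = (1, 1)`, `δ = (s, -s)`, `δ² = s²`.**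
[cite: MoeglinVignerasWaldspurger1987, Chap. 1 I.17] -/
theorem isQuadraticCoordinates_splitReal :
    IsQuadraticCoordinates ((RingHom.id ℝ).prod (RingHom.id ℝ)) (splitRealCoords s hs) ((s, -s) : ℝ × ℝ) (s * s) where
  apply a b := by
    ext
    · show a + b * s = a + b * s
      rfl
    · show a - b * s = a + b * (-s)
      ring
  mul_self := by
    ext
    · rfl
    · show -s * -s = s * s
      ring

omit hs in
/-- the swap fixes the diagonal `ℝ·1`. [cite: MoeglinVignerasWaldspurger1987, Chap. 1 I.17] -/
theorem swap_diag (a : ℝ) :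
    (RingEquiv.prodComm : ℝ × ℝ ≃+* ℝ × ℝ).toRingHom (((RingHom.id ℝ).prod (RingHom.id ℝ)) a) =
      ((RingHom.id ℝ).prod (RingHom.id ℝ)) a := rfl

omit hs in
/-- the swap negates `δ = (s, -s)` (it IS the conjugation `c ⊗ 1`). [cite: MoeglinVignerasWaldspurger1987, Chap. 1 I.17] -/
theorem swap_delta : (RingEquiv.prodComm : ℝ × ℝ ≃+* ℝ × ℝ).toRingHom ((s, -s) : ℝ × ℝ) = -((s, -s) : ℝ × ℝ) := by
  ext
  · rfl
  · show s = - -s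
    rw [neg_neg]

include hs in
/-- `2 s · (2s)⁻¹ = 1`. [cite: MoeglinVignerasWaldspurger1987, Chap. 1 I.17] -/
theorem two_mul_mul_inv_two_mul : 2 * s * (2 * s)⁻¹ = 1 :=
  mul_inv_cancel₀ (mul_ne_zero two_ne_zero hs)

end SplitReal

/-! ## §2 The metaplectic section of `U(swap, T ⊗ 1)(ℝ × ℝ)` -/

section Section

variable (s : ℝ) (hs : s ≠ 0) (n : Type*) [Fintype n] [DecidableEq n]
variable {T : Matrix n n ℝ} (hTd : IsUnit T.det)
variable {H : Matrix n n (ℝ × ℝ)} (hH : H = T.map ((RingHom.id ℝ).prod (RingHom.id ℝ)))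

include hs hTd hH in
/-- **the symplectic embedding of `U(swap, T ⊗ 1)(ℝ × ℝ)`** in Darboux coordinates (the tree's `toSymplecticDot` at
the split real quadratic coordinates). [cite: MoeglinVignerasWaldspurger1987, Chap. 1 I.19] -/
abbrev toSymplecticDotSplitReal (hT : T.IsSymm) :
    unitaryGroupOfForm (RingEquiv.prodComm : ℝ × ℝ ≃+* ℝ × ℝ).toRingHom H →*
      symplecticGroup (polar (dotPairing n)) :=
  (isQuadraticCoordinates_splitReal s hs).toSymplecticDot n hT hTd (swap_diag) (swap_delta s) hH

/-- **the archimedean Weil section at a real split place**: for any lift `x ∈ Mp^𝓢(ℝⁿ)` of `splitCayleyDot⁻¹`,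
`g ↦ x · leviGL(g₊) · x⁻¹` is a homomorphic section of `Mp^𝓢 → Sp` over the symplectic embedding of
`U(swap, T ⊗ 1)(ℝ × ℝ)`. [cite: Kudla1994, §3; Folland1989, §4.2 (4.24)] -/
theorem proj_comp_archSplitSection_splitReal (hT : T.IsSymm) (x : MpS n)
    (hx : MpS.proj x = (splitCayleyDot (two_mul_mul_inv_two_mul s hs) n hTd hT)⁻¹) :
    MpS.proj.comp (archSplitSection (isQuadraticCoordinates_splitReal s hs) rfl n x) =
      toSymplecticDotSplitReal s hs n hTd hH hT :=
  proj_comp_archSplitSection (isQuadraticCoordinates_splitReal s hs) rfl (two_mul_mul_inv_two_mul s hs) n hTd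
    (swap_diag) (swap_delta s) hH hT x hx

include hs hTd hH in
/-- **EXISTENCE of the archimedean Weil section at a real split place**: the unitary group `U(swap, T ⊗ 1)` of the
split real quadratic algebra `ℝ × ℝ` admits a homomorphic section into Folland's metaplectic group over its
symplectic embedding. [cite: Kudla1994, §3; Folland1989, §4.2 (4.23)–(4.24)] -/
theorem exists_archSection_splitReal (hT : T.IsSymm) :
    ∃ sec : unitaryGroupOfForm (RingEquiv.prodComm : ℝ × ℝ ≃+* ℝ × ℝ).toRingHom H →* MpS n,
      MpS.proj.comp sec = toSymplecticDotSplitReal s hs n hTd hH hT :=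
  exists_archSplitSection (isQuadraticCoordinates_splitReal s hs) rfl (two_mul_mul_inv_two_mul s hs) n hTd
    (swap_diag) (swap_delta s) hH hT

/-- the operators of the section: `S_x (|det g₊|^{-1/2} (S_x⁻¹ f) ∘ g₊⁻¹)` with `g₊ = g.map evalPlus` — here
`evalPlus (a, b) = a`, the FIRST (`E_w`-) component of `g ∈ GLₙ(ℝ × ℝ)`. [cite: Folland1989, §4.2 (4.24)] -/
theorem archSplitSection_splitReal_apply_snd (x : MpS n)
    (g : unitaryGroupOfForm (RingEquiv.prodComm : ℝ × ℝ ≃+* ℝ × ℝ).toRingHom H) (f : SchwartzMap (n → ℝ) ℂ) :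
    (archSplitSection (isQuadraticCoordinates_splitReal s hs) rfl n x g).1.2 f =
      x.1.2 (Literature.Analysis.SegalBargmann.leviS
        (SymplecticMatrix.glEquiv ((isQuadraticCoordinates_splitReal s hs).plusGL rfl n g)) (x.1.2.symm f)) :=
  rfl

/-- `evalPlus` of the split real coordinates is the first projection: `evalPlus (a, b) = a`.
[cite: MoeglinVignerasWaldspurger1987, Chap. 1 I.17] -/
theorem evalPlus_splitReal (z : ℝ × ℝ) : (isQuadraticCoordinates_splitReal s hs).evalPlus rfl z = z.1 := by
  rw [IsQuadraticCoordinates.evalPlus_apply, QuadraticCoordinates.re_def, QuadraticCoordinates.im_def]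
  show (z.1 + z.2) / 2 + s * ((z.1 - z.2) / (2 * s)) = z.1
  field_simp
  ring

/-- `evalMinus` of the split real coordinates is the second projection: `evalMinus (a, b) = b`.
[cite: MoeglinVignerasWaldspurger1987, Chap. 1 I.17] -/
theorem evalMinus_splitReal (z : ℝ × ℝ) : (isQuadraticCoordinates_splitReal s hs).evalMinus rfl z = z.2 := by
  rw [IsQuadraticCoordinates.evalMinus_apply, QuadraticCoordinates.re_def, QuadraticCoordinates.im_def]
  show (z.1 + z.2) / 2 - s * ((z.1 - z.2) / (2 * s)) = z.2
  field_simp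
  ring

/-- hence `g₊` is the matrix of first components of `g ∈ GLₙ(ℝ × ℝ)`. [cite: Kudla1994, §3] -/
theorem coe_plusGL_splitReal (g : GL n (ℝ × ℝ)) :
    (((isQuadraticCoordinates_splitReal s hs).plusGL rfl n g : GL n ℝ) : Matrix n n ℝ) =
      (g : Matrix n n (ℝ × ℝ)).map Prod.fst := by
  ext i j
  rw [IsQuadraticCoordinates.coe_plusGL, Matrix.map_apply, Matrix.map_apply, evalPlus_splitReal]

end Section

end Literature.NumberTheory.Weil1964

end
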